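import Summits.CriticalPhenomena.SAWScalingLimit.Theses.SAWTotalPositivity

/-!
# Exterior degree and the critical exit mass — vocabulary of the line `exit-mass-unforced-dive` for the crux
`SAWTotalPositivity.TPToTraversalBound` (stmt-CriticalPhenomena-10687; lead prover c5, crux protocol;
skeleton `Summits/CriticalPhenomena/SAWScalingLimit/Cruxes/TPToTraversalBound/Lines/exit_mass_unforced_dive.lean`,
crux-strategist planner-cstrat-stmt-CriticalPhenomena-10687-p1-0, 2026-08-17)

This file fixes, VERBATIM from the registered skeleton, the two objects of its Vocabulary 0:

* `exteriorDegree Ω δ y` — the number of `ℤ²`-edges at `y` that are not edges of the lattice domain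
  `Ω_δ = discreteDomainGraph Ω δ`;
* `CriticalExitMass` — the Lieb–Simon finite-size criterion read at `x_c`: for every bounded `Ω`, mesh
  `δ > 0` and site `p`, `1 ≤ x_c · Σ_y e(y) · Z_{Ω_δ}(p, y)` with `Z_{Ω_δ}(p, y) = SAW.weight Ω δ p y univ`.
  It is the statement interface of the registered stub `stub_criticalExitMass` (to be proved in its own file
  importing this one); NOTHING is asserted here.

Kept separate from the dive vocabulary of the line (`…TPToTraversalBoundDiveDefs.lean`) because the exit-mass
inequality is a stand-alone tool for every SAW tightness route.

Sources: B. Simon, Commun. Math. Phys. 77 (1980) 111–126 and E. H. Lieb, ibid. 127–135 (finite-size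
criteria: "exit functional < 1 ⇒ exponential decay"); N. Madras, G. Slade, *The Self-Avoiding Walk* (1993)
§1.2 (`μ^n ≤ c_n`, first-exit / concatenation decompositions).  Deliberately NOT here: any theorem of the line (only the one-line API `exteriorDegree_le_four`).
-/

noncomputable section

open MeasureTheory Filter Topology Set Metric
open scoped NNReal ENNReal
open Literature.Probability.LatticeModels
open Literature.Probability.RandomPlanarGeometry
open Summit.CriticalPhenomena.SAWScalingLimit.Theses.SAWTotalPositivity

namespace Summit.CriticalPhenomena.SAWScalingLimit.Theorems.TPToTraversalBound.ExitMass

/-! ## Vocabulary 0 — exterior degree and the critical exit mass -/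

/-- The number of `ℤ²`-edges at `y` that are NOT edges of the lattice domain `Ω_δ = discreteDomainGraph Ω δ`
(edges leaving the vertex set, edges whose segment leaves `Ω̄`, and — for a slit domain — edges into the
past).  For a site outside `Ω_δ` it is `4`. [folklore] -/
def exteriorDegree (Ω : Set ℂ) (δ : ℝ) (y : Site 2) : ℕ :=
  {y' : Site 2 | (zdGraph 2).Adj y y' ∧ ¬ (discreteDomainGraph Ω δ).Adj y y'}.ncard

/-- **CriticalExitMass — the Lieb–Simon criterion read at `x_c`** (statement interface of the registered
stub `stub_criticalExitMass`; nothing is asserted here).  For every bounded `Ω ⊆ ℂ`, mesh `δ > 0` and site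
`p`, the `x_c`-mass of self-avoiding walks of `Ω_δ` from `p`, each endpoint `y` counted with the number
`e(y)` of lattice edges by which a walk of `ℤ²` could LEAVE `Ω_δ` there, is at least `1/x_c = μ`:
`1 ≤ x_c · Σ_y e(y) · Z_{Ω_δ}(p, y)`.  (If it failed for one finite lattice domain, the first-exit
decomposition of the SAWs of `ℤ²` would make the susceptibility finite at `x_c`, contradicting
`c_n x_c^n ≥ 1`.)  Simon 1980 / Lieb 1980 read contrapositively; Madras–Slade 1993 §1.2. -/
def CriticalExitMass : Prop :=
  ∀ (Ω : Set ℂ) (δ : ℝ) (p : Site 2), Bornology.IsBounded Ω → 0 < δ →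
    1 ≤ ENNReal.ofReal SAW.criticalFugacity *
      ∑' y : Site 2, (exteriorDegree Ω δ y : ℝ≥0∞) * SAW.weight Ω δ p y Set.univ

/-! ## Elementary API -/

/-- The exterior degree is at most the degree `4` of `ℤ²` (junk audit of `CriticalExitMass` at a site
outside `Ω_δ`: the nil walk and `e(p) ≤ 4` give `4 x_c ≥ 1`). -/
theorem exteriorDegree_le_four : ∀ (Ω : Set ℂ) (δ : ℝ) (y : Site 2), exteriorDegree Ω δ y ≤ 4 := by
  intro Ω δ y
  classical
  unfold exteriorDegree
  have hsub : {y' : Site 2 | (zdGraph 2).Adj y y' ∧ ¬ (discreteDomainGraph Ω δ).Adj y y'} ⊆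
      ((zdGraph 2).neighborFinset y : Set (Site 2)) := by
    intro y' hy'
    simp only [Finset.mem_coe, SimpleGraph.mem_neighborFinset]
    exact hy'.1
  calc Set.ncard {y' : Site 2 | (zdGraph 2).Adj y y' ∧ ¬ (discreteDomainGraph Ω δ).Adj y y'}
      ≤ Set.ncard ((zdGraph 2).neighborFinset y : Set (Site 2)) :=
        Set.ncard_le_ncard hsub (Finset.finite_toSet _)
    _ = ((zdGraph 2).neighborFinset y).card := Set.ncard_coe_finset _
    _ = 4 := card_neighborFinset_zdGraph_holds (d := 2) y

end Summit.CriticalPhenomena.SAWScalingLimit.Theorems.TPToTraversalBound.ExitMass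

end
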